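import Mathlib
import HarnessLib
import Summits.Ventures.LatticeQCDFlow.Scoring.SplitChainDependsOn

/-!
# Martingale increments along the simulated chain, from any start: orthogonality to the past,
# the conditional second moment `q = kop κ (h²) − (kop κ h)²`, and `E[M_{s,n}²] = Σ_t E[q(X_{s+t})] ≤ n C_h²`

HONEST FRAMING: exact (Metropolis-corrected) sampling algorithms for lattice gauge theory;
figures of merit are autocorrelation/cost numbers at stated couplings and volumes; no
continuum-physics claim.

Venture `LatticeQCDFlow` (cell pub-lqcd), topic `Scoring`; FANOUT row 8 (`s0-cpn-nemc`, GEN-19).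
NEW WORK of the cell, not a published result; no definition is introduced.  `κ` a Markov kernel on a
measurable space, `P_{μ₀}` the path law of its chain from ANY initial law `μ₀` (`Kernel.trajMeasure`,
as in every chain-level file of the row), `h` a bounded measurable observable (`|h| ≤ C_h`).  The
increments `D_t := h(X_{t+1}) − (kop κ h)(X_t)` are martingale differences of the chain's own
filtration: by the tree's tower property in `DependsOn` form
(`Scoring/SplitChainDependsOn.chain_tower_dependsOn`) they are orthogonal to every bounded measurable
functional of the past, and their conditional second moment given the past is the observable
`q := kop κ (h²) − (kop κ h)²` (the one-step conditional variance of `h`, `0 ≤ q ≤ C_h²`) at the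
current state.  Consequently the block martingale `M_{s,n} := Σ_{t<n} D_{s+t}` has
`E_{μ₀}[M_{s,n}²] = Σ_{t<n} E_{μ₀}[q(X_{s+t})] ≤ n C_h²` for every `s`, `n` and every initial law.  This
is the first file of the Poisson–martingale route to the moments of block sums
(`Scoring/ChainMartingaleFourthMoment.lean`, `Scoring/ChainBlockSumMoments.lean`), the input of the
consistency of the batch-means estimator of the asymptotic variance.  Printed counterparts NAMED
ONLY, nothing cited as a fact: the martingale / Poisson-equation approach to additive functionals of
Markov chains (Gordin–Lifšic 1978; Meyn–Tweedie 1993 §17.4).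

## Content (`P_{μ₀}` as above; `|h| ≤ C_h` measurable; `q = kop κ (h²) − (kop κ h)²`;
## `M_{s,n}(x) = Σ_{t<n} (h(x_{s+t+1}) − kop κ h (x_{s+t}))`)

* `kopCondVar_nonneg`, `kopCondVar_le`, `kopCondVar_bounded_measurable` — `0 ≤ q ≤ C_h²`, `q` measurable;
* **`chain_increment_orthogonal`** — `E[G · (h(X_{b+1}) − kop κ h(X_b))] = 0` for bounded measurable
  `G` with `DependsOn G (Set.Iic b)`;
* **`chain_increment_sq`** — `E[G · (h(X_{b+1}) − kop κ h(X_b))²] = E[G · q(X_b)]` for such `G`;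
* `blockMartingale_measurable`, `abs_blockMartingale_le` (`|M_{s,n}| ≤ n · 2C_h`),
  `blockMartingale_dependsOn` (`DependsOn M_{s,n} (Set.Iic (s+n))`);
* **`chain_blockMartingale_sq_eq`** — `E[M_{s,n}²] = Σ_{t<n} E[q(X_{s+t})]`;
* **`chain_blockMartingale_sq_le`** — `E[M_{s,n}²] ≤ n C_h²`.

NOT CLAIMED: anything about a concrete sampler; unbounded `h`; lower bounds.
-/

noncomputable section

namespace Summit.Ventures.LatticeQCDFlow.Scoring

open MeasureTheory ProbabilityTheory Filter Finset Preorder Literature.Probability.MarkovChains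
open scoped ENNReal Topology

variable {Ω : Type*} [MeasurableSpace Ω]

/-! ### Pointwise facts about the conditional variance observable -/

section CondVar

variable (κ : Kernel Ω Ω) [IsMarkovKernel κ]

/-- `0 ≤ kop κ (h²) x − (kop κ h x)²` (Jensen for the probability law `κ x`). -/
theorem kopCondVar_nonneg {h : Ω → ℝ} (hh : Measurable h) {Ch : ℝ} (hCh : ∀ x, |h x| ≤ Ch) (x : Ω) :
    0 ≤ kop κ (fun y => h y ^ 2) x - (kop κ h x) ^ 2 := by
  unfold kop
  linarith [sq_integral_le_integral_sq (κ x) hh hCh]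

/-- `kop κ (h²) x − (kop κ h x)² ≤ C_h²`. -/
theorem kopCondVar_le {h : Ω → ℝ} {Ch : ℝ} (hCh : ∀ x, |h x| ≤ Ch) (x : Ω) :
    kop κ (fun y => h y ^ 2) x - (kop κ h x) ^ 2 ≤ Ch ^ 2 := by
  have h1 : kop κ (fun y => h y ^ 2) x ≤ Ch ^ 2 := by
    have hb : ∀ y, |h y ^ 2| ≤ Ch ^ 2 := fun y => by
      rw [abs_pow]; exact pow_le_pow_left₀ (abs_nonneg _) (hCh y) 2
    exact (le_abs_self _).trans (abs_kop_le κ hb x)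
  linarith [sq_nonneg (kop κ h x)]

/-- `|kop κ (h²) x − (kop κ h x)²| ≤ C_h²`, and the observable is measurable. -/
theorem kopCondVar_bounded_measurable {h : Ω → ℝ} (hh : Measurable h) {Ch : ℝ}
    (hCh : ∀ x, |h x| ≤ Ch) :
    Measurable (fun x => kop κ (fun y => h y ^ 2) x - (kop κ h x) ^ 2) ∧
      ∀ x, |kop κ (fun y => h y ^ 2) x - (kop κ h x) ^ 2| ≤ Ch ^ 2 :=
  ⟨(measurable_kop κ (hh.pow_const 2)).sub ((measurable_kop κ hh).pow_const 2), fun x =>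
    abs_le.2 ⟨by linarith [kopCondVar_nonneg κ hh hCh x, sq_nonneg Ch], kopCondVar_le κ hCh x⟩⟩

end CondVar

/-! ### Martingale increments along the chain -/

section Increments

variable (κ : Kernel Ω Ω) [IsMarkovKernel κ] (μ₀ : Measure Ω) [IsProbabilityMeasure μ₀]

/-- **Martingale increments are orthogonal to the past**: for bounded measurable `G` with
`DependsOn G (Set.Iic b)` and bounded measurable `h`, `E[G · (h(X_{b+1}) − kop κ h (X_b))] = 0`. -/
theorem chain_increment_orthogonal (b : ℕ) {G : (ℕ → Ω) → ℝ} (hG : Measurable G)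
    (hGd : DependsOn G (Set.Iic b)) {CG : ℝ} (hCG : ∀ x, |G x| ≤ CG) {h : Ω → ℝ}
    (hh : Measurable h) {Ch : ℝ} (hCh : ∀ x, |h x| ≤ Ch) :
    ∫ x, G x * (h (x (b + 1)) - kop κ h (x b)) ∂(Kernel.trajMeasure (X := fun _ : ℕ => Ω) μ₀
        (fun n : ℕ => κ.comap (fun h : (i : ↥(Finset.Iic n)) → Ω => h ⟨n, Finset.mem_Iic.2 le_rfl⟩)
          (measurable_pi_apply _))) = 0 := by
  set P := Kernel.trajMeasure (X := fun _ : ℕ => Ω) μ₀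
      (fun n : ℕ => κ.comap (fun h : (i : ↥(Finset.Iic n)) → Ω => h ⟨n, Finset.mem_Iic.2 le_rfl⟩)
        (measurable_pi_apply _)) with hP
  have hCG0 : 0 ≤ CG := (abs_nonneg _).trans (hCG (Classical.choice
    (nonempty_of_isProbabilityMeasure P)))
  have hi1 : Integrable (fun x : ℕ → Ω => G x * h (x (b + 1))) P :=
    integrable_of_bounded P (hG.mul (hh.comp (measurable_pi_apply _))) (C := CG * Ch) fun x => by
      rw [abs_mul]; exact mul_le_mul (hCG x) (hCh _) (abs_nonneg _) hCG0
  have hi2 : Integrable (fun x : ℕ → Ω => G x * kop κ h (x b)) P :=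
    integrable_of_bounded P (hG.mul ((measurable_kop κ hh).comp (measurable_pi_apply _)))
      (C := CG * Ch) fun x => by
      rw [abs_mul]; exact mul_le_mul (hCG x) (abs_kop_le κ hCh _) (abs_nonneg _) hCG0
  have key := chain_tower_dependsOn κ μ₀ b hG hGd hCG hh hCh
  rw [← hP] at key
  simp_rw [mul_sub]
  rw [integral_sub hi1 hi2, key, sub_self]

/-- **Conditional second moment of an increment**: for bounded measurable `G` with
`DependsOn G (Set.Iic b)`: `E[G · (h(X_{b+1}) − kop κ h(X_b))²] = E[G · (kop κ (h²) − (kop κ h)²)(X_b)]`. -/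
theorem chain_increment_sq (b : ℕ) {G : (ℕ → Ω) → ℝ} (hG : Measurable G)
    (hGd : DependsOn G (Set.Iic b)) {CG : ℝ} (hCG : ∀ x, |G x| ≤ CG) {h : Ω → ℝ}
    (hh : Measurable h) {Ch : ℝ} (hCh : ∀ x, |h x| ≤ Ch) :
    ∫ x, G x * (h (x (b + 1)) - kop κ h (x b)) ^ 2 ∂(Kernel.trajMeasure (X := fun _ : ℕ => Ω) μ₀
        (fun n : ℕ => κ.comap (fun h : (i : ↥(Finset.Iic n)) → Ω => h ⟨n, Finset.mem_Iic.2 le_rfl⟩)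
          (measurable_pi_apply _)))
      = ∫ x, G x * (kop κ (fun y => h y ^ 2) (x b) - (kop κ h (x b)) ^ 2)
        ∂(Kernel.trajMeasure (X := fun _ : ℕ => Ω) μ₀
          (fun n : ℕ => κ.comap (fun h : (i : ↥(Finset.Iic n)) → Ω => h ⟨n, Finset.mem_Iic.2 le_rfl⟩)
            (measurable_pi_apply _))) := by
  set P := Kernel.trajMeasure (X := fun _ : ℕ => Ω) μ₀
      (fun n : ℕ => κ.comap (fun h : (i : ↥(Finset.Iic n)) → Ω => h ⟨n, Finset.mem_Iic.2 le_rfl⟩)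
        (measurable_pi_apply _)) with hP
  have hCG0 : 0 ≤ CG := (abs_nonneg _).trans (hCG (Classical.choice
    (nonempty_of_isProbabilityMeasure P)))
  have hCh0 : 0 ≤ Ch := (abs_nonneg _).trans (hCh (Classical.choice
    (nonempty_of_isProbabilityMeasure μ₀)))
  have hh2 : Measurable fun y => h y ^ 2 := hh.pow_const 2
  have hCh2 : ∀ y, |h y ^ 2| ≤ Ch ^ 2 := fun y => by
    rw [abs_pow]; exact pow_le_pow_left₀ (abs_nonneg _) (hCh y) 2
  have hKb : ∀ y, |kop κ h y| ≤ Ch := abs_kop_le κ hCh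
  -- (1) `E[G h(X_{b+1})²] = E[G K(h²)(X_b)]`
  have h1 := chain_tower_dependsOn κ μ₀ b hG hGd hCG hh2 hCh2
  rw [← hP] at h1
  -- (2) `E[(G · Kh(X_b)) h(X_{b+1})] = E[G · Kh(X_b) · Kh(X_b)]`
  have hG'm : Measurable fun x : ℕ → Ω => G x * kop κ h (x b) :=
    hG.mul ((measurable_kop κ hh).comp (measurable_pi_apply _))
  have hG'd : DependsOn (fun x : ℕ → Ω => G x * kop κ h (x b)) (Set.Iic b) := by
    intro x y hxy
    show G x * kop κ h (x b) = G y * kop κ h (y b)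
    rw [hGd hxy, hxy b (Set.mem_Iic.2 le_rfl)]
  have hG'b : ∀ x : ℕ → Ω, |G x * kop κ h (x b)| ≤ CG * Ch := fun x => by
    rw [abs_mul]; exact mul_le_mul (hCG x) (hKb _) (abs_nonneg _) hCG0
  have h2 := chain_tower_dependsOn κ μ₀ b hG'm hG'd hG'b hh hCh
  rw [← hP] at h2
  -- integrability of the three pieces
  have hiA : Integrable (fun x : ℕ → Ω => G x * h (x (b + 1)) ^ 2) P :=
    integrable_of_bounded P (hG.mul (hh2.comp (measurable_pi_apply _))) (C := CG * Ch ^ 2)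
      fun x => by rw [abs_mul]; exact mul_le_mul (hCG x) (hCh2 _) (abs_nonneg _) hCG0
  have hiB : Integrable (fun x : ℕ → Ω => G x * kop κ h (x b) * h (x (b + 1))) P :=
    integrable_of_bounded P (hG'm.mul (hh.comp (measurable_pi_apply _))) (C := CG * Ch * Ch)
      fun x => by
        rw [abs_mul]
        exact mul_le_mul (hG'b x) (hCh _) (abs_nonneg _) (mul_nonneg hCG0 hCh0)
  have hiC : Integrable (fun x : ℕ → Ω => G x * kop κ h (x b) * kop κ h (x b)) P :=
    integrable_of_bounded P (hG'm.mul ((measurable_kop κ hh).comp (measurable_pi_apply _)))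
      (C := CG * Ch * Ch) fun x => by
        rw [abs_mul]
        exact mul_le_mul (hG'b x) (hKb _) (abs_nonneg _) (mul_nonneg hCG0 hCh0)
  have hiD : Integrable (fun x : ℕ → Ω => G x * kop κ (fun y => h y ^ 2) (x b)) P :=
    integrable_of_bounded P (hG.mul ((measurable_kop κ hh2).comp (measurable_pi_apply _)))
      (C := CG * Ch ^ 2) fun x => by
        rw [abs_mul]; exact mul_le_mul (hCG x) (abs_kop_le κ hCh2 _) (abs_nonneg _) hCG0
  have hL : ∀ x : ℕ → Ω, G x * (h (x (b + 1)) - kop κ h (x b)) ^ 2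
      = G x * h (x (b + 1)) ^ 2 - 2 * (G x * kop κ h (x b) * h (x (b + 1)))
        + G x * kop κ h (x b) * kop κ h (x b) := fun x => by ring
  have hR : ∀ x : ℕ → Ω, G x * (kop κ (fun y => h y ^ 2) (x b) - (kop κ h (x b)) ^ 2)
      = G x * kop κ (fun y => h y ^ 2) (x b) - 2 * (G x * kop κ h (x b) * kop κ h (x b))
        + G x * kop κ h (x b) * kop κ h (x b) := fun x => by ring
  have hiAB : Integrable (fun x : ℕ → Ω => G x * h (x (b + 1)) ^ 2
      - 2 * (G x * kop κ h (x b) * h (x (b + 1)))) P := hiA.sub (hiB.const_mul 2)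
  have hiDC : Integrable (fun x : ℕ → Ω => G x * kop κ (fun y => h y ^ 2) (x b)
      - 2 * (G x * kop κ h (x b) * kop κ h (x b))) P := hiD.sub (hiC.const_mul 2)
  rw [integral_congr_ae (ae_of_all _ hL), integral_congr_ae (ae_of_all _ hR),
    integral_add hiAB hiC, integral_sub hiA (hiB.const_mul 2),
    integral_add hiDC hiC, integral_sub hiD (hiC.const_mul 2),
    integral_const_mul, integral_const_mul, h1, h2]

end Increments

/-! ### The block martingale `M_{s,n} = Σ_{t<n} D_{s+t}` -/

section BlockMartingale

variable (κ : Kernel Ω Ω) [IsMarkovKernel κ]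

omit [IsMarkovKernel κ] in
/-- `M_{s,n}` is measurable on path space. -/
theorem blockMartingale_measurable {h : Ω → ℝ} (hh : Measurable h) (s n : ℕ) :
    Measurable fun x : ℕ → Ω => ∑ t ∈ Finset.range n, (h (x (s + t + 1)) - kop κ h (x (s + t))) :=
  Finset.measurable_sum _ fun _ _ =>
    (hh.comp (measurable_pi_apply _)).sub ((measurable_kop κ hh).comp (measurable_pi_apply _))

/-- `|M_{s,n}| ≤ n · 2 C_h`. -/
theorem abs_blockMartingale_le {h : Ω → ℝ} {Ch : ℝ} (hCh : ∀ x, |h x| ≤ Ch) (s n : ℕ)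
    (x : ℕ → Ω) :
    |∑ t ∈ Finset.range n, (h (x (s + t + 1)) - kop κ h (x (s + t)))| ≤ n * (2 * Ch) := by
  calc |∑ t ∈ Finset.range n, (h (x (s + t + 1)) - kop κ h (x (s + t)))|
      ≤ ∑ t ∈ Finset.range n, |h (x (s + t + 1)) - kop κ h (x (s + t))| :=
        Finset.abs_sum_le_sum_abs _ _
    _ ≤ ∑ t ∈ Finset.range n, 2 * Ch := Finset.sum_le_sum fun t _ =>
        (abs_sub _ _).trans (by linarith [hCh (x (s + t + 1)), abs_kop_le κ hCh (x (s + t))])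
    _ = n * (2 * Ch) := by rw [Finset.sum_const, Finset.card_range, nsmul_eq_mul]

omit [MeasurableSpace Ω] in
/-- `M_{s,n}` depends only on the coordinates up to time `s + n`. -/
theorem blockMartingale_dependsOn (K : (Ω → ℝ) → Ω → ℝ) (h : Ω → ℝ) (s n : ℕ) :
    DependsOn (fun x : ℕ → Ω => ∑ t ∈ Finset.range n, (h (x (s + t + 1)) - K h (x (s + t))))
      (Set.Iic (s + n)) := by
  intro x y hxy
  refine Finset.sum_congr rfl fun t ht => ?_
  have ht' := Finset.mem_range.1 ht
  rw [hxy (s + t + 1) (Set.mem_Iic.2 (by omega)), hxy (s + t) (Set.mem_Iic.2 (by omega))]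

variable (μ₀ : Measure Ω) [IsProbabilityMeasure μ₀]

/-- **`E[M_{s,n}²] = Σ_{t<n} E[q(X_{s+t})]`** with `q = kop κ (h²) − (kop κ h)²`. -/
theorem chain_blockMartingale_sq_eq {h : Ω → ℝ} (hh : Measurable h) {Ch : ℝ}
    (hCh : ∀ x, |h x| ≤ Ch) (s : ℕ) : ∀ n : ℕ,
    ∫ x, (∑ t ∈ Finset.range n, (h (x (s + t + 1)) - kop κ h (x (s + t)))) ^ 2
        ∂(Kernel.trajMeasure (X := fun _ : ℕ => Ω) μ₀
          (fun n : ℕ => κ.comap (fun h : (i : ↥(Finset.Iic n)) → Ω => h ⟨n, Finset.mem_Iic.2 le_rfl⟩)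
            (measurable_pi_apply _)))
      = ∑ t ∈ Finset.range n, ∫ x, (kop κ (fun y => h y ^ 2) (x (s + t)) - (kop κ h (x (s + t))) ^ 2)
        ∂(Kernel.trajMeasure (X := fun _ : ℕ => Ω) μ₀
          (fun n : ℕ => κ.comap (fun h : (i : ↥(Finset.Iic n)) → Ω => h ⟨n, Finset.mem_Iic.2 le_rfl⟩)
            (measurable_pi_apply _)))
  | 0 => by simp
  | n + 1 => by
    set P := Kernel.trajMeasure (X := fun _ : ℕ => Ω) μ₀
        (fun n : ℕ => κ.comap (fun h : (i : ↥(Finset.Iic n)) → Ω => h ⟨n, Finset.mem_Iic.2 le_rfl⟩)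
          (measurable_pi_apply _)) with hP
    have ih := chain_blockMartingale_sq_eq hh hCh s n
    rw [← hP] at ih
    have hCh0 : 0 ≤ Ch := (abs_nonneg _).trans (hCh (Classical.choice
      (nonempty_of_isProbabilityMeasure μ₀)))
    -- the pieces
    have hMm := blockMartingale_measurable κ hh s n
    have hMb := abs_blockMartingale_le κ hCh s n
    have hMd := blockMartingale_dependsOn (kop κ) h s n
    have hDm : Measurable fun x : ℕ → Ω => h (x (s + n + 1)) - kop κ h (x (s + n)) :=
      (hh.comp (measurable_pi_apply _)).sub ((measurable_kop κ hh).comp (measurable_pi_apply _))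
    have hDb : ∀ x : ℕ → Ω, |h (x (s + n + 1)) - kop κ h (x (s + n))| ≤ 2 * Ch := fun x =>
      (abs_sub _ _).trans (by linarith [hCh (x (s + n + 1)), abs_kop_le κ hCh (x (s + n))])
    -- orthogonality and conditional second moment
    have horth := chain_increment_orthogonal κ μ₀ (s + n) hMm hMd hMb hh hCh
    rw [← hP] at horth
    have hsq := chain_increment_sq κ μ₀ (s + n) (G := fun _ => (1 : ℝ)) measurable_const
      (dependsOn_const _ |>.mono (Set.empty_subset _)) (CG := 1) (fun _ => by simp) hh hCh
    rw [← hP] at hsq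
    simp only [one_mul] at hsq
    -- integrability
    have hiM2 : Integrable (fun x : ℕ → Ω =>
        (∑ t ∈ Finset.range n, (h (x (s + t + 1)) - kop κ h (x (s + t)))) ^ 2) P :=
      integrable_of_bounded P (hMm.pow_const 2) (C := (n * (2 * Ch)) ^ 2) fun x => by
        rw [abs_pow]; exact pow_le_pow_left₀ (abs_nonneg _) (hMb x) 2
    have hiMD : Integrable (fun x : ℕ → Ω =>
        (∑ t ∈ Finset.range n, (h (x (s + t + 1)) - kop κ h (x (s + t))))
          * (h (x (s + n + 1)) - kop κ h (x (s + n)))) P :=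
      integrable_of_bounded P (hMm.mul hDm) (C := n * (2 * Ch) * (2 * Ch)) fun x => by
        rw [abs_mul]
        exact mul_le_mul (hMb x) (hDb x) (abs_nonneg _) (by positivity)
    have hiD2 : Integrable (fun x : ℕ → Ω => (h (x (s + n + 1)) - kop κ h (x (s + n))) ^ 2) P :=
      integrable_of_bounded P (hDm.pow_const 2) (C := (2 * Ch) ^ 2) fun x => by
        rw [abs_pow]; exact pow_le_pow_left₀ (abs_nonneg _) (hDb x) 2
    have hexp : ∀ x : ℕ → Ω,
        (∑ t ∈ Finset.range (n + 1), (h (x (s + t + 1)) - kop κ h (x (s + t)))) ^ 2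
        = (∑ t ∈ Finset.range n, (h (x (s + t + 1)) - kop κ h (x (s + t)))) ^ 2
          + 2 * ((∑ t ∈ Finset.range n, (h (x (s + t + 1)) - kop κ h (x (s + t))))
            * (h (x (s + n + 1)) - kop κ h (x (s + n))))
          + (h (x (s + n + 1)) - kop κ h (x (s + n))) ^ 2 := fun x => by
      rw [Finset.sum_range_succ]; ring
    have hi12 : Integrable (fun x : ℕ → Ω =>
        (∑ t ∈ Finset.range n, (h (x (s + t + 1)) - kop κ h (x (s + t)))) ^ 2
          + 2 * ((∑ t ∈ Finset.range n, (h (x (s + t + 1)) - kop κ h (x (s + t))))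
            * (h (x (s + n + 1)) - kop κ h (x (s + n))))) P := hiM2.add (hiMD.const_mul 2)
    rw [integral_congr_ae (ae_of_all _ hexp), integral_add hi12 hiD2,
      integral_add hiM2 (hiMD.const_mul 2), integral_const_mul, horth, mul_zero, add_zero, ih,
      hsq, Finset.sum_range_succ]

/-- **`E[M_{s,n}²] ≤ n C_h²`.** -/
theorem chain_blockMartingale_sq_le {h : Ω → ℝ} (hh : Measurable h) {Ch : ℝ}
    (hCh : ∀ x, |h x| ≤ Ch) (s n : ℕ) :
    ∫ x, (∑ t ∈ Finset.range n, (h (x (s + t + 1)) - kop κ h (x (s + t)))) ^ 2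
        ∂(Kernel.trajMeasure (X := fun _ : ℕ => Ω) μ₀
          (fun n : ℕ => κ.comap (fun h : (i : ↥(Finset.Iic n)) → Ω => h ⟨n, Finset.mem_Iic.2 le_rfl⟩)
            (measurable_pi_apply _)))
      ≤ n * Ch ^ 2 := by
  set P := Kernel.trajMeasure (X := fun _ : ℕ => Ω) μ₀
      (fun n : ℕ => κ.comap (fun h : (i : ↥(Finset.Iic n)) → Ω => h ⟨n, Finset.mem_Iic.2 le_rfl⟩)
        (measurable_pi_apply _)) with hP
  have heq := chain_blockMartingale_sq_eq κ μ₀ hh hCh s n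
  rw [← hP] at heq
  rw [heq]
  have hterm : ∀ t ∈ Finset.range n,
      ∫ x, (kop κ (fun y => h y ^ 2) (x (s + t)) - (kop κ h (x (s + t))) ^ 2) ∂P ≤ Ch ^ 2 := by
    intro t _
    calc ∫ x, (kop κ (fun y => h y ^ 2) (x (s + t)) - (kop κ h (x (s + t))) ^ 2) ∂P
        ≤ ∫ x, Ch ^ 2 ∂P :=
          integral_mono_of_nonneg (ae_of_all _ fun x => kopCondVar_nonneg κ hh hCh _)
            (integrable_const _) (ae_of_all _ fun x => kopCondVar_le κ hCh _)
      _ = Ch ^ 2 := by rw [integral_const, smul_eq_mul, probReal_univ, one_mul]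
  calc ∑ t ∈ Finset.range n, ∫ x, (kop κ (fun y => h y ^ 2) (x (s + t)) - (kop κ h (x (s + t))) ^ 2) ∂P
      ≤ ∑ t ∈ Finset.range n, Ch ^ 2 := Finset.sum_le_sum hterm
    _ = n * Ch ^ 2 := by rw [Finset.sum_const, Finset.card_range, nsmul_eq_mul]

end BlockMartingale

end Summit.Ventures.LatticeQCDFlow.Scoring

end
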